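import Literature.NumberTheory.NumberFields.QuadraticExtensionFrobeniusProofs
import Mathlib.NumberTheory.RamificationInertia.Galois
import Mathlib.FieldTheory.Perfect
import Mathlib.RingTheory.LocalRing.ResidueField.Ideal
import HarnessLib

/-!
# The non-trivial automorphism of a quadratic Galois extension lies in the inertia group of a ramified place

Topic `NumberTheory/NumberFields` (namespace `Literature.NumberTheory.NumberFields`). PROOFS ONLY (no definition, no named
fact, no `sorry`). Sequel of `QuadraticExtensionPlacesProofs` / `QuadraticExtensionFrobeniusProofs` (`L/K` quadratic Galois with a
given `τ ≠ 1`):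

* **`smul_sub_mem_of_ramificationIdx_eq_two`** — if `w ∣ v` has ramification index `e(w|v) = 2` then `τ` acts trivially on the residue
  field: `τ • x − x ∈ w` for every `x ∈ 𝓞 L` (`τ` lies in the inertia group `I(w|v)`, which has order `e = 2 = #Gal(L/K)` by Mathlib's
  `Ideal.ncard_primesOver_mul_card_inertia_mul_finrank`).

Requested by route `BiquadraticEisensteinDescent` of `Summits/BirchSwinnertonDyer` (crux `EisensteinHeartFlatCMInertBadKPrime`, hypothesis (L),
side condition `hramL` of `…DeuringOverKPrime.polynomial_identity`: in `L = K_CM·K′`, `L/K′` ramifies only above primes dividing `d_CM`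
— apply the congruence to `√d_CM`, on which `τ` acts by `−1`, to get `2√d_CM ∈ w`).

References: [NeukirchANT1999] Ch. I §9 (9.6) (inertia group, `#I = e`); [Marcus2018] Ch. 4 (Thm. 28).
-/

noncomputable section

open scoped NumberField Pointwise
open NumberField IsDedekindDomain
open Literature.NumberTheory.Automorphic

namespace Literature.NumberTheory.NumberFields

variable {K L : Type} [Field K] [Field L] [NumberField K] [NumberField L] [Algebra K L] [IsGalois K L]

/-- **At a ramified place of a quadratic Galois extension, `τ` lies in the inertia group**: if `e(w|v) = 2` then
`τ • x − x ∈ w` for all `x ∈ 𝓞 L`. Indeed `#{w' ∣ v} · #I(w|v) · f(w|v) = #Gal(L/K) = 2` with `#{w' ∣ v} = f(w|v) = 1`, so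
`I(w|v) = Gal(L/K) ∋ τ`. [cite: NeukirchANT1999, Ch. I §9 (9.6)] -/
theorem smul_sub_mem_of_ramificationIdx_eq_two (h2 : Module.finrank K L = 2) {τ : L ≃ₐ[K] L} (hτ : τ ≠ 1)
    {w : HeightOneSpectrum (𝓞 L)} {v : HeightOneSpectrum (𝓞 K)} (hw : w.under (𝓞 K) = v)
    (he : w.asIdeal.ramificationIdx (𝓞 K) = 2) (x : 𝓞 L) : τ • x - x ∈ w.asIdeal := by
  classical
  haveI := w.isPrime
  haveI := v.isPrime
  haveI : w.asIdeal.LiesOver v.asIdeal := ⟨by rw [← hw]; rfl⟩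
  haveI : IsGaloisGroup (L ≃ₐ[K] L) (𝓞 K) (𝓞 L) := IsGaloisGroup.of_isFractionRing _ _ _ K L
  haveI : Finite (𝓞 K ⧸ v.asIdeal) := Ideal.finiteQuotientOfFreeOfNeBot v.asIdeal v.ne_bot
  -- `τ • w = w` (one place above `v`): otherwise `e(w|v) = 1`
  have hτw : τ • w = w := by
    by_contra hne
    have h1 := (ramificationIdx_eq_one_and_inertiaDeg_eq_one_of_smul_ne h2 hτ hw hne).1
    omega
  have hef := ramificationIdx_mul_inertiaDeg_eq_two_of_smul_eq h2 hτ hw hτw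
  have hf1 : w.asIdeal.inertiaDeg (𝓞 K) = 1 := by
    rw [he] at hef; omega
  -- `#I(w|v) = 2 = #Gal(L/K)`
  have hG : Nat.card (L ≃ₐ[K] L) = 2 := by rw [IsGalois.card_aut_eq_finrank, h2]
  have hn : (v.asIdeal.primesOver (𝓞 L)).ncard = 1 := by
    rw [ncard_primesOver_eq h2 hτ hw, hτw, Set.pair_eq_singleton, Set.ncard_singleton]
  have hcard := Ideal.ncard_primesOver_mul_card_inertia_mul_finrank (G := L ≃ₐ[K] L) v.asIdeal w.asIdeal
  rw [hn, hf1, one_mul, mul_one, hG] at hcard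
  -- hence the inertia subgroup is everything
  have htop : w.asIdeal.inertia (L ≃ₐ[K] L) = ⊤ := by
    refine Subgroup.eq_top_of_card_eq _ ?_
    rw [hcard, hG]
  have hmem : τ ∈ w.asIdeal.inertia (L ≃ₐ[K] L) := by rw [htop]; exact Subgroup.mem_top τ
  exact hmem x

end Literature.NumberTheory.NumberFields

end
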